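import Summits.HodgeConjecture.HodgeConjecture.Theorems.NikulinTwinTransportSquareGlueEndomorphisms

/-!
# Route NikulinTwinTransport · frame item `Assembly` (stmt-HodgeConjecture-13942) —
# the `H² ⊗ H²` engine of the glue WITHOUT the coniveau fact

Helper toward a version of the frame/glue whose trust base does not contain
`Grothendieck1969_supportedClasses_le_hodgeConiveau` ("`N¹H² ⊆ H^{1,1}`", Deligne's mixed Hodge
theory behind it). The two theorems of `…SquareGlueEndomorphisms` (seat 13682:
`exists_sum_rankOne_of_hodgeEndomorphism`, `exists_algebraicClass_of_hodgeEndomorphism`) use that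
named fact at exactly one place — to know that the divisor classes `N¹H²(S)` of the K3 surface at
hand are of type `(1,1)`. Here the same two statements are re-derived VERBATIM with that single
input taken as a per-surface hypothesis
`hN11 : ∀ d ∈ algebraicClasses S 1, IsOfHodgeType 2 S (2 * 1) 1 1 d`
(`…_of_oneOne`); for a surface carrying real multiplication `e` with `eσ = λσ`, `λ ≠ 0`, that
hypothesis is FREE (`isOfHodgeType_oneOne_of_mem_algebraicClasses_of_ne_zero`,
`…AssemblyLambdaSplit`), and the case `λ = 0` needs no engine at all (`…AssemblySquareAllAlgebraic`).
The proofs are those of seat 13682 (prover-pitem-stmt-HodgeConjecture-13682-0), copied with the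
one-line change; the originals are the special case `hN11 := isOfHodgeType_oneOne_of_mem_algebraicClasses hG hS`.

No new definitions, no named facts. Prover seat prover-pitem-stmt-HodgeConjecture-13942-0.
-/

noncomputable section

namespace Summit.HodgeConjecture.HodgeConjecture.Theorems.NikulinTwinTransport

open scoped Manifold
open Module CategoryTheory MonoidalCategory CartesianMonoidalCategory
open Literature.AlgebraicGeometry.Motives Literature.AlgebraicGeometry.HodgeTheory
open Literature.AlgebraicGeometry.Surfaces Literature.Geometry.Kaehler
open Literature.AlgebraicTopology.SingularHomology

section Endo

variable {S : SchemeOver ℂ}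

/-- **Rational Hodge endomorphisms of `H²` of a marked projective K3 surface with
`End_Hdg(T) ⊆ ℚ + ℚe` are sums of rank-one divisor maps plus `ℚ·id + ℚ·e`** — the statement of
`exists_sum_rankOne_of_hodgeEndomorphism` with the coniveau fact replaced by the per-surface
hypothesis `hN11` (the divisor classes of `S` are of type `(1,1)`); same proof.
[cite: Varesco2023, §2 (p. 8)] [cite: Huybrechts2016K3, Ch. 3 §3.2 and Lemma 3.3.1] -/
theorem exists_sum_rankOne_of_hodgeEndomorphism_of_oneOne (hHT : Huybrechts_K3_hodgeTypes_H2)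
    (hS : IsK3Surface S)
    (hN11 : ∀ d ∈ algebraicClasses S 1, IsOfHodgeType 2 S (2 * 1) 1 1 d)
    (hL11 : ∀ c : complexBetti S (2 * 1), IsRationalClass c → IsOfHodgeType 2 S (2 * 1) 1 1 c →
      c ∈ algebraicClasses S 1)
    (η : complexBetti S (2 * 1) ≃ₗ[ℂ] (K3Index → ℂ)) (p₀ : complexBetti S (2 * 2)) (hp₀ : p₀ ≠ 0)
    (hηint : ∀ c : complexBetti S (2 * 1), IsIntegralClass c ↔ ∃ v : K3Index → ℤ, η c = fun i => (v i : ℂ))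
    (hηcup : ∀ a b : complexBetti S (2 * 1),
      cupProduct (rfl : 2 * 1 + 2 * 1 = 2 * 2) a b = k3Form (η a) (η b) • p₀)
    (x : K3Index → ℂ) (hx20 : IsOfHodgeType 2 S (2 * 1) 2 0 (η.symm x))
    (hx20' : ∀ τ : complexBetti S (2 * 1), IsOfHodgeType 2 S (2 * 1) 2 0 τ → ∃ t : ℂ, τ = t • η.symm x)
    (hxne : η.symm x ≠ 0)
    (e : complexBetti S (2 * 1) →ₗ[ℂ] complexBetti S (2 * 1))
    (he_rat : ∀ y, IsRationalClass y → IsRationalClass (e y))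
    (he_N : ∀ d ∈ algebraicClasses S 1, e d = 0)
    (he_T : ∀ y : complexBetti S (2 * 1),
      (∀ d ∈ algebraicClasses S 1, cupProduct (rfl : 2 * 1 + 2 * 1 = 2 * 2) y d = 0) → e (e y) = (2 : ℂ) • y)
    (hU : ∀ (f : complexBetti S (2 * 1) →ₗ[ℂ] complexBetti S (2 * 1)),
      (∀ y, IsRationalClass y → IsRationalClass (f y)) →
      (∀ (i j : ℕ) y, IsOfHodgeType 2 S (2 * 1) i j y → IsOfHodgeType 2 S (2 * 1) i j (f y)) →
      (∀ d ∈ algebraicClasses S 1, f d = 0) →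
      (∀ y : complexBetti S (2 * 1), ∀ d ∈ algebraicClasses S 1,
        cupProduct (rfl : 2 * 1 + 2 * 1 = 2 * 2) (f y) d = 0) →
      ∃ a b : ℚ, ∀ y : complexBetti S (2 * 1),
        (∀ d ∈ algebraicClasses S 1, cupProduct (rfl : 2 * 1 + 2 * 1 = 2 * 2) y d = 0) →
        f y = (a : ℂ) • y + (b : ℂ) • e y)
    (F : complexBetti S (2 * 1) →ₗ[ℂ] complexBetti S (2 * 1))
    (hF_rat : ∀ y, IsRationalClass y → IsRationalClass (F y))
    (hF_typ : ∀ (i j : ℕ) y, IsOfHodgeType 2 S (2 * 1) i j y → IsOfHodgeType 2 S (2 * 1) i j (F y)) :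
    ∃ (m : ℕ) (a b : Fin m → K3Index → ℚ) (r s : ℚ),
      (∀ i, η.symm (fun j => (a i j : ℂ)) ∈ algebraicClasses S 1) ∧
      (∀ i, η.symm (fun j => (b i j : ℂ)) ∈ algebraicClasses S 1) ∧
      ∀ y, F y = ∑ i, k3Form (η y) (fun j => (a i j : ℂ)) • η.symm (fun j => (b i j : ℂ)) +
        (r : ℂ) • y + (s : ℂ) • e y := by
  classical
  set N := algebraicClasses S 1 with hNdef
  set σ := η.symm x with hσdef
  set σbar := conjClass (ComplexPoints S) (2 * 1) σ with hσbardef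
  set xbar := η σbar with hxbardef
  have hησ : η σ = x := by rw [hσdef, LinearEquiv.apply_symm_apply]
  obtain ⟨h₁, h₂, h₃⟩ := hHT S hS σ hx20 hxne
  have hσbar02 : IsOfHodgeType 2 S (2 * 1) 0 2 σbar := (h₂ σbar).2 ⟨1, (one_smul ℂ _).symm⟩
  -- injectivity of `c ↦ c • p₀`
  have hsmul0 : ∀ {c : ℂ}, c • p₀ = 0 → c = 0 := fun h => by
    rcases smul_eq_zero.1 h with h | h
    · exact h
    · exact absurd h hp₀
  -- rational classes are `Λ_ℚ`
  have hrat : ∀ c, IsRationalClass c ↔ ∃ w : K3Index → ℚ, η c = fun i => (w i : ℂ) :=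
    isRationalClass_iff_of_marking hS η hηint
  -- the rational points of `N`
  let NQ : Submodule ℚ (K3Index → ℚ) :=
    { carrier := {u | η.symm (fun j => (u j : ℂ)) ∈ N}
      add_mem' := fun {u v} hu hv => by
        simp only [Set.mem_setOf_eq, ratCastΛ_add, map_add]
        exact N.add_mem hu hv
      zero_mem' := by
        simp only [Set.mem_setOf_eq, ratCastΛ_zero, map_zero]
        exact N.zero_mem
      smul_mem' := fun q u hu => by
        simp only [Set.mem_setOf_eq, ratCastΛ_smul, map_smul]
        exact N.smul_mem _ hu }
  have memNQ : ∀ u, u ∈ NQ ↔ η.symm (fun j => (u j : ℂ)) ∈ N := fun u => Iff.rfl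
  -- (1,1)-classes through the marking
  have h11_iff : ∀ v : K3Index → ℂ, IsOfHodgeType 2 S (2 * 1) 1 1 (η.symm v) ↔
      (k3Form v x = 0 ∧ k3Form v xbar = 0) := by
    intro v
    rw [h₃ (η.symm v), hηcup, hηcup, LinearEquiv.apply_symm_apply, hησ, ← hxbardef]
    constructor
    · rintro ⟨ha, hb⟩
      exact ⟨hsmul0 ha, hsmul0 hb⟩
    · rintro ⟨ha, hb⟩
      rw [ha, hb, zero_smul]
      exact ⟨rfl, rfl⟩
  -- `N_ℚ = Λ_ℚ ∩ {x, x̄}^⊥`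
  have hN : ∀ u : K3Index → ℚ, u ∈ NQ ↔
      (k3Form (fun i => (u i : ℂ)) x = 0 ∧ k3Form (fun i => (u i : ℂ)) xbar = 0) := by
    intro u
    rw [memNQ, ← h11_iff]
    constructor
    · intro hu
      exact hN11 _ hu
    · intro hu
      exact hL11 _ ((hrat _).2 ⟨u, LinearEquiv.apply_symm_apply _ _⟩) hu
  have hNx : ∀ n ∈ NQ, k3Form (fun i => (n i : ℂ)) x = 0 := fun n hn => ((hN n).1 hn).1
  have hNxbar : ∀ n ∈ NQ, k3Form (fun i => (n i : ℂ)) xbar = 0 := fun n hn => ((hN n).1 hn).2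
  -- `N` is spanned by its rational classes: `N_ℚ^⊥ ⊗ ℂ ⊥ N`
  have hspan := span_isRationalClass_eq_top_of_isSmoothProjective_holds.supportedClasses_eq_span
    hS.1 (2 * 1) 1
  have horth : ∀ u ∈ k3FormRat.orthogonal NQ, ∀ d ∈ N, k3Form (fun j => (u j : ℂ)) (η d) = 0 := by
    intro u hu d hd
    rw [LinearMap.BilinForm.mem_orthogonal_iff] at hu
    have hd' : d ∈ Submodule.span ℂ {c : complexBetti S (2 * 1) |
        IsRationalClass c ∧ c ∈ supportedClasses S (2 * 1) 1} := by
      rw [← hspan]; exact hd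
    clear hd
    induction hd' using Submodule.span_induction with
    | mem d hd =>
      obtain ⟨w, hw⟩ := (hrat d).1 hd.1
      have hwN : w ∈ NQ := by
        rw [memNQ, ← hw, LinearEquiv.symm_apply_apply]
        exact hd.2
      rw [hw, k3Form_ratCast, k3FormRat_isSymm.eq, hu w hwN, Rat.cast_zero]
    | zero => rw [map_zero, k3Form_zero_right]
    | add c c' _ _ hc hc' => rw [map_add, k3Form_add_right, hc, hc', add_zero]
    | smul t c _ hc => rw [map_smul, k3Form_smul_right, hc, mul_zero]
  have horth' : ∀ u ∈ k3FormRat.orthogonal NQ, ∀ d ∈ N,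
      cupProduct (rfl : 2 * 1 + 2 * 1 = 2 * 2) (η.symm fun j => (u j : ℂ)) d = 0 := fun u hu d hd => by
    rw [hηcup, LinearEquiv.apply_symm_apply, horth u hu d hd, zero_smul]
  -- `e` on `Λ_ℚ`
  obtain ⟨ε, hε⟩ := exists_ratEnd_of_forall_intCast (η.toLinearMap ∘ₗ e ∘ₗ η.symm.toLinearMap)
    (markingConj_intCast hS η hηint η hηint e he_rat)
  have hε' : ∀ u : K3Index → ℚ, η (e (η.symm fun j => (u j : ℂ))) = fun j => (ε u j : ℂ) := fun u => by
    simpa only [LinearMap.coe_comp, LinearEquiv.coe_coe, Function.comp_apply] using hε u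
  have hεN : ∀ u ∈ NQ, ε u = 0 := by
    intro u hu
    apply ratCastΛ_injective
    rw [← hε' u, he_N _ ((memNQ u).1 hu), map_zero, ratCastΛ_zero]
  have hεT : ∀ u ∈ k3FormRat.orthogonal NQ, ε (ε u) = (2 : ℚ) • u := by
    intro u hu
    have h2 := he_T _ (horth' u hu)
    have hεx : ∀ v : K3Index → ℚ, e (η.symm fun j => (v j : ℂ)) = η.symm fun j => (ε v j : ℂ) := fun v => by
      rw [← hε' v, LinearEquiv.symm_apply_apply]
    rw [hεx, hεx, ← LinearEquiv.map_smul, ← Rat.cast_ofNat, ← ratCastΛ_smul] at h2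
    exact ratCastΛ_injective (η.symm.injective h2)
  -- `F` on `Λ_ℚ` and its complexification `M = η F η⁻¹`
  obtain ⟨φ, hφ⟩ := exists_ratEnd_of_forall_intCast (η.toLinearMap ∘ₗ F ∘ₗ η.symm.toLinearMap)
    (markingConj_intCast hS η hηint η hηint F hF_rat)
  set M : Module.End ℂ (K3Index → ℂ) := η.toLinearMap ∘ₗ F ∘ₗ η.symm.toLinearMap with hMdef
  have hMapp : ∀ v, M v = η (F (η.symm v)) := fun v => rfl
  have hM : ∀ u : K3Index → ℚ, M (fun i => (u i : ℂ)) = fun i => (φ u i : ℂ) := hφ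
  have hMx : ∃ c : ℂ, M x = c • x := by
    obtain ⟨t, ht⟩ := hx20' _ (hF_typ 2 0 σ hx20)
    exact ⟨t, by rw [hMapp, ← hσdef, ht, map_smul, hησ]⟩
  have hMxbar : ∃ c : ℂ, M xbar = c • xbar := by
    obtain ⟨t, ht⟩ := (h₂ _).1 (hF_typ 0 2 σbar hσbar02)
    exact ⟨t, by rw [hMapp, hxbardef, LinearEquiv.symm_apply_apply, ht, map_smul]⟩
  have hM11 : ∀ v : K3Index → ℂ, k3Form v x = 0 → k3Form v xbar = 0 →
      k3Form (M v) x = 0 ∧ k3Form (M v) xbar = 0 := by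
    intro v hvx hvxbar
    have hv11 : IsOfHodgeType 2 S (2 * 1) 1 1 (η.symm v) := (h11_iff v).2 ⟨hvx, hvxbar⟩
    have hFv := hF_typ 1 1 _ hv11
    rw [← LinearEquiv.symm_apply_apply η (F (η.symm v)), h11_iff] at hFv
    exact hFv
  -- the uniqueness clause, read on `Λ_ℚ`
  have hUQ : ∀ (f : (K3Index → ℚ) →ₗ[ℚ] (K3Index → ℚ)) (Mf : Module.End ℂ (K3Index → ℂ)),
      (∀ u : K3Index → ℚ, Mf (fun i => (u i : ℂ)) = fun i => (f u i : ℂ)) →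
      (∃ c : ℂ, Mf x = c • x) → (∃ c : ℂ, Mf xbar = c • xbar) →
      (∀ v : K3Index → ℂ, k3Form v x = 0 → k3Form v xbar = 0 →
        k3Form (Mf v) x = 0 ∧ k3Form (Mf v) xbar = 0) →
      (∀ n ∈ NQ, f n = 0) → (∀ u, f u ∈ k3FormRat.orthogonal NQ) →
      ∃ a b : ℚ, ∀ t ∈ k3FormRat.orthogonal NQ, f t = a • t + b • ε t := by
    intro f Mf hMf hMfx hMfxbar hMf11 hfN hfT
    let fV : complexBetti S (2 * 1) →ₗ[ℂ] complexBetti S (2 * 1) :=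
      η.symm.toLinearMap ∘ₗ Mf ∘ₗ η.toLinearMap
    have hfV : ∀ y, fV y = η.symm (Mf (η y)) := fun y => rfl
    have hfVrat : ∀ u : K3Index → ℚ, fV (η.symm fun j => (u j : ℂ)) = η.symm fun j => (f u j : ℂ) := fun u => by
      rw [hfV, LinearEquiv.apply_symm_apply, hMf]
    -- (i) rational
    have h_rat : ∀ y, IsRationalClass y → IsRationalClass (fV y) := by
      intro y hy
      obtain ⟨u, hu⟩ := (hrat y).1 hy
      have hy' : y = η.symm (fun j => (u j : ℂ)) := by rw [← hu, LinearEquiv.symm_apply_apply]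
      rw [hy', hfVrat]
      exact (hrat _).2 ⟨f u, LinearEquiv.apply_symm_apply _ _⟩
    -- (ii) type-preserving
    have h_typ : ∀ (i j : ℕ) y, IsOfHodgeType 2 S (2 * 1) i j y → IsOfHodgeType 2 S (2 * 1) i j (fV y) := by
      refine typePreserving_of_lines hHT hS hx20 hxne fV ?_ ?_ ?_
      · obtain ⟨c, hc⟩ := hMfx
        exact ⟨c, by rw [hfV, hησ, hc, map_smul, ← hσdef]⟩
      · obtain ⟨c, hc⟩ := hMfxbar
        refine ⟨c, ?_⟩
        rw [hfV, ← hσbardef, ← hxbardef, hc, map_smul, hxbardef, LinearEquiv.symm_apply_apply]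
      · intro v hv
        have hv' := hv
        rw [← LinearEquiv.symm_apply_apply η v, h11_iff] at hv'
        have h := hMf11 (η v) hv'.1 hv'.2
        rw [hfV, h11_iff]
        exact h
    -- (iii) kills `N`
    have h_N : ∀ d ∈ N, fV d = 0 := by
      intro d hd
      have hd' : d ∈ Submodule.span ℂ {c : complexBetti S (2 * 1) |
          IsRationalClass c ∧ c ∈ supportedClasses S (2 * 1) 1} := by
        rw [← hspan]; exact hd
      clear hd
      induction hd' using Submodule.span_induction with
      | mem d hd =>
        obtain ⟨w, hw⟩ := (hrat d).1 hd.1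
        have hd'' : d = η.symm (fun j => (w j : ℂ)) := by rw [← hw, LinearEquiv.symm_apply_apply]
        have hwN : w ∈ NQ := by rw [memNQ, ← hd'']; exact hd.2
        rw [hd'', hfVrat, hfN w hwN, ratCastΛ_zero, map_zero]
      | zero => exact map_zero fV
      | add c c' _ _ hc hc' => rw [map_add, hc, hc', add_zero]
      | smul t c _ hc => rw [map_smul, hc, smul_zero]
    -- (iv) image orthogonal to `N`
    have h_perp : ∀ y : complexBetti S (2 * 1), ∀ d ∈ N,
        cupProduct (rfl : 2 * 1 + 2 * 1 = 2 * 2) (fV y) d = 0 := by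
      intro y d hd
      have hzero : (k3FormC.flip (η d)) ∘ₗ Mf = 0 := by
        refine eq_of_forall_ratCast fun u => ?_
        rw [LinearMap.comp_apply, hMf, LinearMap.BilinForm.flip_apply, k3FormC_apply, LinearMap.zero_apply]
        exact horth (f u) (hfT u) d hd
      have h := LinearMap.congr_fun hzero (η y)
      rw [LinearMap.comp_apply, LinearMap.BilinForm.flip_apply, k3FormC_apply, LinearMap.zero_apply] at h
      rw [hηcup, hfV, LinearEquiv.apply_symm_apply, h, zero_smul]
    obtain ⟨a, b, hab⟩ := hU fV h_rat h_typ h_N h_perp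
    refine ⟨a, b, fun t ht => ?_⟩
    have h := hab (η.symm fun j => (t j : ℂ)) (horth' t ht)
    rw [hfVrat] at h
    have h' := congrArg η h
    rw [LinearEquiv.apply_symm_apply, map_add, map_smul, map_smul, LinearEquiv.apply_symm_apply, hε',
      ← ratCastΛ_smul, ← ratCastΛ_smul, ← ratCastΛ_add] at h'
    exact ratCastΛ_injective h'
  -- the linear algebra
  obtain ⟨m, aQ, bQ, r, s, haQ, hbQ, hdec⟩ :=
    exists_rankOne_decomposition x xbar NQ hN ε hεN hεT φ M hM hMx hMxbar hM11 hUQ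
  refine ⟨m, aQ, bQ, r, s, fun i => (memNQ _).1 (haQ i), fun i => (memNQ _).1 (hbQ i), ?_⟩
  -- lift the identity from `Λ_ℚ` to `H²(S(ℂ); ℂ)`
  let R : complexBetti S (2 * 1) →ₗ[ℂ] complexBetti S (2 * 1) :=
    ∑ i, ((k3FormC.flip (fun j => (aQ i j : ℂ))) ∘ₗ η.toLinearMap).smulRight
        (η.symm fun j => (bQ i j : ℂ)) +
      (r : ℂ) • LinearMap.id + (s : ℂ) • e
  have hR : ∀ y, R y = ∑ i, k3Form (η y) (fun j => (aQ i j : ℂ)) • η.symm (fun j => (bQ i j : ℂ)) +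
      (r : ℂ) • y + (s : ℂ) • e y := fun y => by
    simp only [R, LinearMap.add_apply, LinearMap.sum_apply, LinearMap.smulRight_apply, LinearMap.comp_apply,
      LinearEquiv.coe_coe, LinearMap.BilinForm.flip_apply, k3FormC_apply, LinearMap.smul_apply,
      LinearMap.id_apply]
  have hFR : F ∘ₗ η.symm.toLinearMap = R ∘ₗ η.symm.toLinearMap := by
    refine eq_of_forall_ratCast fun u => ?_
    rw [LinearMap.comp_apply, LinearMap.comp_apply, LinearEquiv.coe_coe, hR, LinearEquiv.apply_symm_apply]
    have hFu : F (η.symm fun j => (u j : ℂ)) = η.symm (fun j => (φ u j : ℂ)) := by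
      rw [← hM u, hMapp, LinearEquiv.symm_apply_apply]
    have heu : e (η.symm fun j => (u j : ℂ)) = η.symm (fun j => (ε u j : ℂ)) := by
      rw [← hε' u, LinearEquiv.symm_apply_apply]
    rw [hFu, heu, hdec u, ratCastΛ_add, ratCastΛ_add, map_add, map_add, ratCastΛ_sum, map_sum,
      ratCastΛ_smul, ratCastΛ_smul, map_smul, map_smul]
    congr 2
    refine Finset.sum_congr rfl fun i _ => ?_
    rw [ratCastΛ_smul, map_smul, k3Form_ratCast]
  intro y
  have h := LinearMap.congr_fun hFR (η y)
  rw [LinearMap.comp_apply, LinearMap.comp_apply, LinearEquiv.coe_coe, LinearEquiv.symm_apply_apply] at h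
  rw [h, hR]

/-- `Corr[μ, hS ; γ, y] = fst_*(snd^* y ∪ γ) = [γ]_* y` on `H²(S(ℂ); ℂ)`, symbol for symbol the shape of the route's
statements (`RealMultiplicationSqrtTwoAlgebraic`, `TwinSimilitudeAlgebraic`). Local notation only. -/
local notation3 (prettyPrint := false) "Corr[" μ ", " hS " ; " γ ", " y "]" =>
  complexGysin μ (IsSmoothProjective.tensor_holds (And.left hS) (And.left hS)) (And.left hS)
    (SemiCartesianMonoidalCategory.fst _ _) (rfl : 2 * 1 + 2 * 2 + 2 * 2 = 2 * 1 + 2 * (2 + 2))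
    (cupProduct (rfl : 2 * 1 + 2 * 2 = 2 * 1 + 2 * 2)
      (complexBetti.map (SemiCartesianMonoidalCategory.snd _ _) (2 * 1) y) γ)

/-- **Every rational Hodge endomorphism of `H²(S)` is induced by an algebraic class on `S × S`**
(projective K3 surface `S` with algebraic real multiplication `e = [γₑ]_*` and
`End_Hdg(T) ⊆ ℚ + ℚe`) — the statement of `exists_algebraicClass_of_hodgeEndomorphism` with the
coniveau fact replaced by the per-surface hypothesis `hN11`; same proof.
[cite: Varesco2023, §2 (p. 8)] [cite: Fulton1998, §16.1] -/
theorem exists_algebraicClass_of_hodgeEndomorphism_of_oneOne (hmark : Huybrechts_K3_marking_exists)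
    (hHT : Huybrechts_K3_hodgeTypes_H2)
    (μ : OrientationFamily) (hS : IsK3Surface S)
    (hN11 : ∀ d ∈ algebraicClasses S 1, IsOfHodgeType 2 S (2 * 1) 1 1 d)
    (hKtop : ∀ z : complexBetti (S ⊗ S) (2 * (2 + 2)), z ∈ Submodule.span ℂ
      {v | ∃ (i j : ℕ) (h : i + j = 2 * (2 + 2)) (b : complexBetti S i) (w : complexBetti S j),
        v = cupProduct h (complexBetti.map (fst S S) i b) (complexBetti.map (snd S S) j w)})
    (hL11 : ∀ c : complexBetti S (2 * 1), IsRationalClass c → IsOfHodgeType 2 S (2 * 1) 1 1 c →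
      c ∈ algebraicClasses S 1)
    (e : complexBetti S (2 * 1) →ₗ[ℂ] complexBetti S (2 * 1))
    (he_rat : ∀ y, IsRationalClass y → IsRationalClass (e y))
    (he_N : ∀ d ∈ algebraicClasses S 1, e d = 0)
    (he_T : ∀ y : complexBetti S (2 * 1),
      (∀ d ∈ algebraicClasses S 1, cupProduct (rfl : 2 * 1 + 2 * 1 = 2 * 2) y d = 0) → e (e y) = (2 : ℂ) • y)
    (hγe : ∃ γ ∈ algebraicClasses (S ⊗ S) 2, ∀ y : complexBetti S (2 * 1), e y = Corr[μ, hS ; γ, y])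
    (hU : ∀ (f : complexBetti S (2 * 1) →ₗ[ℂ] complexBetti S (2 * 1)),
      (∀ y, IsRationalClass y → IsRationalClass (f y)) →
      (∀ (i j : ℕ) y, IsOfHodgeType 2 S (2 * 1) i j y → IsOfHodgeType 2 S (2 * 1) i j (f y)) →
      (∀ d ∈ algebraicClasses S 1, f d = 0) →
      (∀ y : complexBetti S (2 * 1), ∀ d ∈ algebraicClasses S 1,
        cupProduct (rfl : 2 * 1 + 2 * 1 = 2 * 2) (f y) d = 0) →
      ∃ a b : ℚ, ∀ y : complexBetti S (2 * 1),
        (∀ d ∈ algebraicClasses S 1, cupProduct (rfl : 2 * 1 + 2 * 1 = 2 * 2) y d = 0) →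
        f y = (a : ℂ) • y + (b : ℂ) • e y)
    (F : complexBetti S (2 * 1) →ₗ[ℂ] complexBetti S (2 * 1))
    (hF_rat : ∀ y, IsRationalClass y → IsRationalClass (F y))
    (hF_typ : ∀ (i j : ℕ) y, IsOfHodgeType 2 S (2 * 1) i j y → IsOfHodgeType 2 S (2 * 1) i j (F y)) :
    ∃ Γ ∈ algebraicClasses (S ⊗ S) 2, ∀ y : complexBetti S (2 * 1), F y = Corr[μ, hS ; Γ, y] := by
  classical
  obtain ⟨η, p₀, x, hp₀, ⟨-, -, hηint, hηcup, hx20, hx20'⟩, -, hxpos, -⟩ := hmark S hS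
  have hxne : η.symm x ≠ 0 := by
    intro h0
    have hx : x = 0 := by
      have := congrArg η h0
      simpa using this
    subst hx
    simp [k3Form] at hxpos
  obtain ⟨m, aQ, bQ, r, s, haQ, hbQ, hF⟩ := exists_sum_rankOne_of_hodgeEndomorphism_of_oneOne hHT hS hN11 hL11 η p₀ hp₀
    hηint hηcup x hx20 hx20' hxne e he_rat he_N he_T hU F hF_rat hF_typ
  obtain ⟨κ, hκ0, hκ⟩ := exists_fibreIntegral_fst μ hS.1 hS.1 hKtop hp₀
    (rfl : 2 * 2 + 2 * 2 = 0 + 2 * (2 + 2))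
  obtain ⟨γe, hγe_alg, hγe⟩ := hγe
  -- the classes: products of divisors, the diagonal, `γₑ`
  set α : Fin m → complexBetti S (2 * 1) := fun i => η.symm fun j => (aQ i j : ℂ) with hαdef
  set β : Fin m → complexBetti S (2 * 1) := fun i => η.symm fun j => (bQ i j : ℂ) with hβdef
  set γ : Fin m → complexBetti (S ⊗ S) (2 * 2) := fun i => cupProduct (rfl : 2 * 1 + 2 * 1 = 2 * 2)
    (complexBetti.map (fst S S) (2 * 1) (β i)) (complexBetti.map (snd S S) (2 * 1) (α i)) with hγdef
  have hγalg : ∀ i, γ i ∈ algebraicClasses (S ⊗ S) 2 := fun i =>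
    cupProduct_fst_snd_mem_algebraicClasses_of_eq hS.1 hS.1 (hbQ i) (haQ i) (rfl : 1 + 1 = 2) _
  set δ : complexBetti (S ⊗ S) (2 * 2) := complexGysin μ hS.1 (IsSmoothProjective.tensor_holds hS.1 hS.1)
    (lift (𝟙 S) (𝟙 S)) (rfl : 0 + 2 * (2 + 2) = 2 * 2 + 2 * 2) (singularCohomology.one ℂ (ComplexPoints S))
    with hδdef
  have hδalg : δ ∈ algebraicClasses (S ⊗ S) 2 := diagonal_mem_algebraicClasses μ hS.1 _
  refine ⟨∑ i, κ⁻¹ • γ i + (r : ℂ) • δ + (s : ℂ) • γe, ?_, fun y => ?_⟩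
  · exact Submodule.add_mem _ (Submodule.add_mem _
      (Submodule.sum_mem _ fun i _ => Submodule.smul_mem _ _ (hγalg i)) (Submodule.smul_mem _ _ hδalg))
      (Submodule.smul_mem _ _ hγe_alg)
  · -- `[Γ]_*` is linear in `Γ`; compute the three pieces
    have hcoef : ∀ i, cupProduct (rfl : 2 * 1 + 2 * 1 = 2 * 2) y (α i) =
        k3Form (η y) (fun j => (aQ i j : ℂ)) • p₀ := fun i => by
      rw [hηcup, hαdef, LinearEquiv.apply_symm_apply]
    have hγact : ∀ i, Corr[μ, hS ; γ i, y] = (k3Form (η y) (fun j => (aQ i j : ℂ)) * κ) • β i := fun i => by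
      rw [hγdef, corrFst_cross_of_cup_eq μ hS.1 hS.1 (rfl : 2 * 1 + 2 * 1 = 2 * 2) _
        (rfl : 2 * 1 + 2 * 1 = 2 * 2) _ (rfl : 2 * 2 + 2 * 2 = 0 + 2 * (2 + 2)) hκ (β i) (hcoef i)]
      norm_num
    have hδact : Corr[μ, hS ; δ, y] = y := corrFst_diagonal μ hS.1 (rfl : 2 * 1 + 2 * 2 = 2 * 1 + 2 * 2) _ _ y
    rw [hF y]
    simp only [map_add, map_sum, map_smul, hγact, hδact, ← hγe y, smul_smul]
    congr 2
    refine Finset.sum_congr rfl fun i _ => ?_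
    congr 1
    field_simp

end Endo

end Summit.HodgeConjecture.HodgeConjecture.Theorems.NikulinTwinTransport

end
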